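import Summits.PneNP.PneNP.Theorems.ConvexRankGatesLinAlgGateBlindGRankLogWidth

/-!
# Route ConvexRankGates, crux `LinAlgGateBlind` (stmt-PneNP-10681): the span-dimension door — the bits of a GRANK gate are the dimension of the span of its matrices

Support theorems for the crux (vocabulary of `Theorems/ConvexRankGatesLinAlgGateBlindDefs.lean`). The span cover of
`…GRankChainCover` selects `≤ dim_F F^{d×d} = d²` live atoms spanning the live span; selecting them INSIDE the span of all
the gate's matrices instead (`exists_subset_card_le_finrank_span_range`) shows that the only quantity the cover sees is
`D = dim_F span{Kᵢ}` — neither the dimension `d` of the matrices, nor the threshold `θ`, nor the field: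

* `sgAt_gRankSpan_of_chain_budget` — finite SG form for the inline class `GRANKSPAN_D` of generic-rank threshold gates
  `[θ ≤ rank (K₀ + ∑_{vᵢ=1} Xᵢ Kᵢ)]` (any `d`, `θ`, `K₀`, any field) with `dim_F span{Kᵢ} ≤ D`, cover exponent `D`;
* `sgAt_gRankSpan_logWidth`, `isTermGate_gRankSpan_collapse`, `not_computes_clique_of_isOver_gRankSpan_logWidth` — at the
  logarithmic width: for every `c`, eventually in `m`, for every `D ≤ m^{7/8}/(log₂ m)^5`, the single-gate statement for
  `GRANKSPAN_D` and the unconditional lower bound: no circuit with `≤ m^c` gates over `{∧₂, ∨₂} ∪ GRANKSPAN_D` computes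
  `CLIQUE(m, ⌈m^{1/8}⌉)` (collapse `GRANKSPAN_D ∘ OR ⊆ GRANKSPAN_D`: rewiring repeats matrices, the span does not grow);
* `gRank_subset_gRankSpan` — `GRANK_s ⊆ GRANKSPAN_{s²}`, so this is the master form of the GRANK door `sgAt_gRank_logWidth`
  (and the rank-threshold gates of threshold `t` of `…GRankThreshold` land in `GRANKSPAN_{t²}` after compression).

The PERM door reads `log₂ |G| ≤ m^{7/8}/polylog` (`…LogWidthOrder`), the GRANK door `dim_F span{Kᵢ} ≤ m^{7/8}/polylog`:
both are "bits of the ambient algebraic structure below the union-bound budget". Sources: Edmonds 1967 §5 Thm. 1;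
Razborov 1985, Alon–Boppana 1987 §3; planting theorem, host and covers are the tree's. No new definitions. [folklore]
-/

-- `Summit.PneNP.PneNP.…` duplicates `PneNP` BY DESIGN (single-problem summit).
set_option linter.dupNamespace false

noncomputable section

namespace Summit.PneNP.PneNP.Theorems

open Finset Filter Literature.Computability.Complexity Razborov
open Summit.PneNP.PneNP.Cruxes.LinAlgGateBlind.DnfInvariantWideGatesSeeSmallCliques
open Summit.PneNP.PneNP.Cruxes.LinAlgGateBlind.DnfInvariantWideGatesSeeSmallCliques.DenseRegime

/-! ### Few spanning vectors, counted inside their own span -/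

/-- **Few spanning vectors suffice, counted by the dimension of the span of the whole family.** From any finite
sub-family `r i, i ∈ I` of a finite family of vectors one can select `J ⊆ I` with the same span and
`#J ≤ dim span{r i : all i}` (apply `exists_subset_card_le_finrank_span_eq` inside that span). [folklore] -/
theorem exists_subset_card_le_finrank_span_range {F V ι : Type*} [DivisionRing F] [AddCommGroup V] [Module F V]
    [Fintype ι] [DecidableEq ι] (r : ι → V) (I : Finset ι) :
    ∃ J ⊆ I, #J ≤ Module.finrank F (Submodule.span F (Set.range r)) ∧
      Submodule.span F (r '' (J : Set ι)) = Submodule.span F (r '' (I : Set ι)) := by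
  classical
  set W := Submodule.span F (Set.range r) with hW
  haveI : Module.Finite F W := Module.Finite.span_of_finite F (Set.finite_range r)
  set r' : ι → W := fun i => ⟨r i, Submodule.subset_span ⟨i, rfl⟩⟩ with hr'
  obtain ⟨J, hJI, hcard, hJ⟩ := exists_subset_card_le_finrank_span_eq (F := F) r' I
  refine ⟨J, hJI, hcard, ?_⟩
  have hmap : ∀ T : Finset ι,
      (Submodule.span F (r' '' (T : Set ι))).map W.subtype = Submodule.span F (r '' (T : Set ι)) := by
    intro T
    rw [Submodule.map_span, ← Set.image_comp]
    rfl
  rw [← hmap J, ← hmap I, hJ]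

/-! ### SG for the span-dimension class from the span cover -/

/-- **The span cover at span dimension `D` (finite form of SG for `GRANKSPAN_D`).** Let `q ∈ [0,1]`,
`1 - q^{C(l,2)} ≤ 1/2`, `0 < ε`, `2t ≤ l`, the positive budget `(ν·C(l,2))^t · C(m-t, k-t) ≤ ε·C(m,k)` and the fragility
budget `#𝒱(l)^D · (1/2)^{ν+1} · #𝒱(l) < ε`. Then every term gate of the inline class `GRANKSPAN_D` — a generic-rank
threshold gate `[θ ≤ rank (K₀ + ∑_{⌈X_a⌉(x)=1} X_a K_a)]` of any dimension and threshold over any field whose matrices span a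
space of dimension `≤ D` — is `ε`-approximated one-sidedly by a small-clique DNF: the proof of
`sgAt_gRank_of_chain_budget` verbatim with the live atoms selected inside `span{K_a}` (`≤ D` of them,
`exists_subset_card_le_finrank_span_range`), span reduction `le_rank_symbolicMatrix_iff_of_mem_span`, monotonicity, and the
planting theorem `sg_of_maxtermCover`. [folklore] -/
theorem sgAt_gRankSpan_of_chain_budget : ∀ (m l k D ν t : ℕ) (q ε : ℝ), 0 ≤ q → q ≤ 1 →
    1 - q ^ (l.choose 2) ≤ 1 / 2 → 0 < ε → 2 * t ≤ l →
    (((ν * l.choose 2) ^ t * (m - t).choose (k - t) : ℕ) : ℝ) ≤ ε * (m.choose k : ℝ) →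
    (#(smallSets (Fin m) l) : ℝ) ^ D * (1 / 2) ^ (ν + 1) * #(smallSets (Fin m) l) < ε →
    SGAt m (fun g => ∃ (F : Type) (_ : Field F) (d θ : ℕ) (K₀ : Matrix (Fin d) (Fin d) F)
      (K : Fin g.1 → Matrix (Fin d) (Fin d) F), Module.finrank F (Submodule.span F (Set.range K)) ≤ D ∧
        ∀ v : Fin g.1 → Bool, g.2 v = true ↔ θ ≤ (symbolicMatrix K₀ K v).rank) l k q ε := by
  intro m l k D ν t q ε hq0 hq1 hql hε htl hpos hfrag O hO
  classical
  obtain ⟨g, ⟨F, _, d, θ, K₀, K, hD, hgK⟩, X, hX, hOX⟩ := hO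
  have hmono : Monotone g.2 := IsGRankGate.monotone ⟨F, inferInstance, d, θ, le_rfl, K₀, K, hgK⟩
  set V := smallSets (Fin m) l with hVdef
  have hV : (0 : ℝ) < #V := Nat.cast_pos.2 (card_pos.2 ⟨∅, empty_mem_smallSets l⟩)
  -- the live inputs of a graph
  set lv : (KEdge m → Bool) → Fin g.1 → Bool := fun x a => atomB (X a) x with hlv
  have hlv_iff : ∀ x a, lv x a = true ↔ CliquePresent (X a) x := fun x a => by simp [hlv, atomB]
  -- the subspace spanned by the matrices of the atoms listed by `f`, and its indicator
  set W : (Fin D → V) → Submodule F (Matrix (Fin d) (Fin d) F) :=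
    fun f => Submodule.span F (K '' {a | ∃ i, ((f i : V) : Finset (Fin m)) = X a}) with hWdef
  set wf : (Fin D → V) → Fin g.1 → Bool := fun f a => decide (K a ∈ W f) with hwf
  -- the span cover
  have hiff : ∀ x, O x = false ↔
      ∃ f : Fin D → V, g.2 (wf f) = false ∧ ∀ a, K a ∉ W f → ¬ CliquePresent (X a) x := by
    intro x
    constructor
    · intro h0
      -- few live atoms span the live span
      obtain ⟨J, hJI, hJcard, hJ⟩ :=
        exists_subset_card_le_finrank_span_range (F := F) K (univ.filter fun a => CliquePresent (X a) x)
      have hIset : ((univ.filter fun a => CliquePresent (X a) x : Finset (Fin g.1)) : Set (Fin g.1)) =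
          {a | CliquePresent (X a) x} := by
        ext a
        simp
      rw [hIset] at hJ
      -- the atoms of `J`, listed as a `D`-tuple padded with `∅`
      set 𝒥 : Finset (Finset (Fin m)) := J.image X with h𝒥def
      have h𝒥V : 𝒥 ⊆ V := by
        intro Y hY
        obtain ⟨a, -, rfl⟩ := mem_image.1 hY
        exact hX a
      have h𝒥card : #𝒥 ≤ D := card_image_le.trans (hJcard.trans hD)
      set e𝒥 := 𝒥.equivFin with he𝒥
      set f : Fin D → V := fun i =>
        if h : (i : ℕ) < #𝒥 then ⟨(e𝒥.symm ⟨i, h⟩ : Finset (Fin m)), h𝒥V (e𝒥.symm ⟨i, h⟩).2⟩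
        else ⟨∅, empty_mem_smallSets l⟩ with hfdef
      have hf_live : ∀ a, (∃ i, ((f i : V) : Finset (Fin m)) = X a) → CliquePresent (X a) x := by
        rintro a ⟨i, hi⟩
        by_cases h : (i : ℕ) < #𝒥
        · have hmem : X a ∈ 𝒥 := by
            rw [← hi, hfdef]
            simp only [h, dif_pos]
            exact (e𝒥.symm ⟨i, h⟩).2
          obtain ⟨b, hb, hba⟩ := mem_image.1 hmem
          have hb_live : CliquePresent (X b) x := (mem_filter.1 (hJI hb)).2
          rw [← hba]
          exact hb_live
        · have hempty : X a = ∅ := by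
            rw [← hi, hfdef]
            simp only [h, dif_neg, not_false_eq_true]
          rw [hempty]
          exact cliquePresent_empty x
      have hJ_listed : ∀ b ∈ J, ∃ i, ((f i : V) : Finset (Fin m)) = X b := by
        intro b hb
        have hXb : X b ∈ 𝒥 := mem_image_of_mem X hb
        refine ⟨⟨e𝒥 ⟨X b, hXb⟩, lt_of_lt_of_le (e𝒥 ⟨X b, hXb⟩).2 h𝒥card⟩, ?_⟩
        rw [hfdef]
        simp only [(e𝒥 ⟨X b, hXb⟩).2, dif_pos, Fin.eta, Equiv.symm_apply_apply]
      have hWf : W f = Submodule.span F (K '' {a | CliquePresent (X a) x}) := by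
        apply le_antisymm
        · refine Submodule.span_le.2 ?_
          rintro _ ⟨a, ha, rfl⟩
          exact Submodule.subset_span ⟨a, hf_live a ha, rfl⟩
        · rw [← hJ]
          exact Submodule.span_mono (Set.image_mono fun b hb => hJ_listed b hb)
      -- span reduction: `g (w_f) = g (live) = O x = 0`
      have hle : lv x ≤ wf f := by
        intro a ha
        rw [hwf]
        simp only [decide_eq_true_eq]
        rw [hWf]
        exact Submodule.subset_span ⟨a, (hlv_iff x a).1 ha, rfl⟩
      have hspan : ∀ a, wf f a = true → K a ∈ Submodule.span F (K '' {b | lv x b = true}) := by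
        intro a ha
        have hset : {b | lv x b = true} = {b | CliquePresent (X b) x} := Set.ext fun b => hlv_iff x b
        rw [hset, ← hWf]
        simpa [hwf] using ha
      have hrej : g.2 (wf f) = false := by
        have hOx : g.2 (lv x) = false := by rw [← hOX x]; exact h0
        have h := (hgK (wf f)).trans ((le_rank_symbolicMatrix_iff_of_mem_span K₀ K hle hspan θ).trans
          (hgK (lv x)).symm)
        rw [hOx] at h
        cases hval : g.2 (wf f)
        · rfl
        · exact absurd (h.1 hval) Bool.false_ne_true
      refine ⟨f, hrej, fun a ha hla => ha ?_⟩
      rw [hWf]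
      exact Submodule.subset_span ⟨a, hla, rfl⟩
    · rintro ⟨f, hrej, hf⟩
      have hle : lv x ≤ wf f := by
        intro a ha
        rw [hwf]
        simp only [decide_eq_true_eq]
        by_contra hK
        exact hf a hK ((hlv_iff x a).1 ha)
      have h := hmono hle
      rw [hrej] at h
      rw [hOX x]
      cases hval : g.2 (lv x)
      · rfl
      · rw [show g.2 (fun a => atomB (X a) x) = g.2 (lv x) from rfl, hval] at h
        exact absurd h (by decide)
  -- index the span cover
  set J := {f : Fin D → V // g.2 (wf f) = false} with hJ
  set N := Nat.card J with hNdef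
  set e : J ≃ Fin N := Finite.equivFin J with he
  set 𝓛 : Fin N → Finset (Finset (Fin m)) :=
    fun j => (univ.filter fun a => K a ∉ W (e.symm j).1).image X with h𝓛
  have hNle : (N : ℝ) ≤ (#V : ℝ) ^ D := by
    have h1 : N ≤ Nat.card (Fin D → V) :=
      Nat.card_le_card_of_injective (Subtype.val : J → (Fin D → V)) Subtype.val_injective
    have h2 : Nat.card (Fin D → V) = #V ^ D := by
      rw [Nat.card_eq_fintype_card, Fintype.card_fun, Fintype.card_fin, Fintype.card_coe]
    rw [h2] at h1
    exact_mod_cast h1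
  have hN : (N : ℝ) * (1 / 2) ^ (ν + 1) < ε / #V := by
    rw [lt_div_iff₀ hV]
    calc (N : ℝ) * (1 / 2) ^ (ν + 1) * #V ≤ (#V : ℝ) ^ D * (1 / 2) ^ (ν + 1) * #V := by gcongr
      _ < ε := hfrag
  have h1 : ∀ j, 𝓛 j ⊆ V := by
    intro j Y hY
    obtain ⟨a, -, rfl⟩ := mem_image.1 hY
    exact hX a
  have h2 : ∀ x, O x = false → ∃ j, ∀ Y ∈ 𝓛 j, ¬ CliquePresent Y x := by
    intro x hx
    obtain ⟨f, hrej, hf⟩ := (hiff x).1 hx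
    refine ⟨e ⟨f, hrej⟩, fun Y hY => ?_⟩
    obtain ⟨a, ha, rfl⟩ := mem_image.1 hY
    rw [mem_filter, Equiv.symm_apply_apply] at ha
    exact hf a ha.2
  have h3 : ∀ j x, (∀ Y ∈ 𝓛 j, ¬ CliquePresent Y x) → O x = false := fun j x hall =>
    (hiff x).2 ⟨(e.symm j).1, (e.symm j).2, fun a ha =>
      hall (X a) (mem_image_of_mem X (mem_filter.2 ⟨mem_univ a, ha⟩))⟩
  obtain ⟨𝒜, h𝒜, hP, hNg⟩ := sg_of_maxtermCover m l k N ν t q (ε / #V) O 𝓛 h1 h2 h3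
    hq0 hq1 hql (div_pos hε hV) hN htl
  refine ⟨𝒜, h𝒜, ?_, hNg.trans_eq (mul_div_cancel₀ ε hV.ne')⟩
  calc (#(lostPos m k O 𝒜) : ℝ) ≤ (((ν * l.choose 2) ^ t * (m - t).choose (k - t) : ℕ) : ℝ) := by
        exact_mod_cast hP
    _ ≤ ε * (m.choose k : ℝ) := hpos

/-- `GRANK_s ⊆ GRANKSPAN_{s²}`: the matrices of a GRANK gate of dimension `d ≤ s` span a space of dimension
`≤ dim F^{d×d} = d² ≤ s²`. [folklore] -/
theorem gRank_subset_gRankSpan (s : ℕ) :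
    {g : GateFn | IsGRankGate s g} ⊆ {g | ∃ (F : Type) (_ : Field F) (d θ : ℕ) (K₀ : Matrix (Fin d) (Fin d) F)
      (K : Fin g.1 → Matrix (Fin d) (Fin d) F), Module.finrank F (Submodule.span F (Set.range K)) ≤ s * s ∧
        ∀ v : Fin g.1 → Bool, g.2 v = true ↔ θ ≤ (symbolicMatrix K₀ K v).rank} := by
  rintro g ⟨F, _, d, θ, hd, K₀, K, hg⟩
  refine ⟨F, inferInstance, d, θ, K₀, K, ?_, hg⟩
  calc Module.finrank F (Submodule.span F (Set.range K)) ≤ Module.finrank F (Matrix (Fin d) (Fin d) F) :=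
        Submodule.finrank_le _
    _ = d * d := by rw [Module.finrank_matrix, Fintype.card_fin, Module.finrank_self, mul_one]
    _ ≤ s * s := Nat.mul_le_mul hd hd

/-! ### At logarithmic width -/

/-- **`SGAt` for `GRANKSPAN_D`, `D ≤ m^{7/8}/(log₂ m)^5`, at the logarithmic width, at every level `c`, eventually in `m`**:
`sgAt_gRankSpan_of_chain_budget` with the budgets of `logWidth_common` at `T = Λ·L·(D+1)` and the cover budget
`#𝒱(L)^D 2^{-(ν+1)} #𝒱(L) < ε` (`cover_budget_two_pow`). [folklore] -/
theorem sgAt_gRankSpan_logWidth : ∀ c : ℕ, ∀ᶠ m : ℕ in atTop, ∀ D : ℕ,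
    (D : ℝ) ≤ (m : ℝ) ^ (7 / 8 : ℝ) / Real.logb 2 m ^ 5 →
      SGAt m (fun g => ∃ (F : Type) (_ : Field F) (d θ : ℕ) (K₀ : Matrix (Fin d) (Fin d) F)
          (K : Fin g.1 → Matrix (Fin d) (Fin d) F), Module.finrank F (Submodule.span F (Set.range K)) ≤ D ∧
            ∀ v : Fin g.1 → Bool, g.2 v = true ↔ θ ≤ (symbolicMatrix K₀ K v).rank)
        ((2 * c + 8) * (Nat.log 2 m + 1)) (kOf m) (qOf m) (epsOf c m) := by
  intro c
  filter_upwards [logWidth_common c] with m hm D hD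
  have hT : ((((Nat.log 2 m + 1) * ((2 * c + 8) * (Nat.log 2 m + 1)) * (D + 1) : ℕ) : ℝ)) ≤
      16 * ((c : ℝ) + 4) * Real.logb 2 m ^ 2 * ((m : ℝ) ^ (7 / 8 : ℝ) / Real.logb 2 m ^ 5) := by
    obtain ⟨-, -, -, -, -, -, -, -, -, -, hℓ1, h5, hΛL⟩ := hm 0 (by
      push_cast
      exact mul_nonneg (mul_nonneg (by positivity) (sq_nonneg _))
        (div_nonneg (Real.rpow_nonneg (Nat.cast_nonneg m) _) (pow_nonneg (logb_two_nonneg m) 5)))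
    have hβ1 : 1 ≤ (m : ℝ) ^ (7 / 8 : ℝ) / Real.logb 2 m ^ 5 := by
      rw [le_div_iff₀ (by positivity), one_mul]; exact h5
    have hD1 : ((D : ℝ) + 1) ≤ 2 * ((m : ℝ) ^ (7 / 8 : ℝ) / Real.logb 2 m ^ 5) := by linarith
    push_cast
    have h0 : (0 : ℝ) ≤ ((Nat.log 2 m : ℝ) + 1) * ((2 * (c : ℝ) + 8) * ((Nat.log 2 m : ℝ) + 1)) := by positivity
    calc ((Nat.log 2 m : ℝ) + 1) * ((2 * (c : ℝ) + 8) * ((Nat.log 2 m : ℝ) + 1)) * ((D : ℝ) + 1)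
        ≤ (8 * ((c : ℝ) + 4) * Real.logb 2 m ^ 2) * (2 * ((m : ℝ) ^ (7 / 8 : ℝ) / Real.logb 2 m ^ 5)) :=
          mul_le_mul hΛL hD1 (by positivity) (by positivity)
      _ = 16 * ((c : ℝ) + 4) * Real.logb 2 m ^ 2 * ((m : ℝ) ^ (7 / 8 : ℝ) / Real.logb 2 m ^ 5) := by ring
  obtain ⟨hm1, hq0, hq1, hhalf, hε, h2t, -, hpos, hB, hmΛ, -, -, -⟩ := hm _ hT
  refine sgAt_gRankSpan_of_chain_budget m _ (kOf m) D _ _ (qOf m) (epsOf c m) hq0 hq1 hhalf hε h2t hpos ?_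
  have hV := card_smallSets_le_two_pow m ((2 * c + 8) * (Nat.log 2 m + 1))
  have hVR : (#(smallSets (Fin m) ((2 * c + 8) * (Nat.log 2 m + 1))) : ℝ) ≤
      (2 : ℝ) ^ ((Nat.log 2 m + 1) * ((2 * c + 8) * (Nat.log 2 m + 1))) := by exact_mod_cast hV
  refine cover_budget_two_pow (a := (Nat.log 2 m + 1) * ((2 * c + 8) * (Nat.log 2 m + 1)) * D)
    (Λ := Nat.log 2 m + 1) hm1 (by positivity) ?_ hVR ?_ hmΛ
  · calc (#(smallSets (Fin m) ((2 * c + 8) * (Nat.log 2 m + 1))) : ℝ) ^ D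
        ≤ ((2 : ℝ) ^ ((Nat.log 2 m + 1) * ((2 * c + 8) * (Nat.log 2 m + 1)))) ^ D :=
          pow_le_pow_left₀ (Nat.cast_nonneg _) hVR D
      _ = (2 : ℝ) ^ ((Nat.log 2 m + 1) * ((2 * c + 8) * (Nat.log 2 m + 1)) * D) := (pow_mul _ _ _).symm
  · have h1 : (Nat.log 2 m + 1) * ((2 * c + 8) * (Nat.log 2 m + 1)) * D +
        (Nat.log 2 m + 1) * ((2 * c + 8) * (Nat.log 2 m + 1)) =
        (Nat.log 2 m + 1) * ((2 * c + 8) * (Nat.log 2 m + 1)) * (D + 1) := by ring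
    omega

/-! ### Collapse and the circuit lower bound -/

/-- **Collapse `GRANKSPAN_D ∘ OR ⊆ GRANKSPAN_D`.** A `GRANKSPAN_D` gate fed with small-clique DNFs `⌈A_i⌉`, `A_i ⊆ 𝒱(l)`, is
a `GRANKSPAN_D` term gate over the atoms `X ∈ ⋃ A_i`: rewire `K'_{(i,X)} := K_i` (same `F, d, θ, K₀`; the rewired family has
its range inside the old one, so its span does not grow) and use `le_rank_symbolicMatrix_rewire_iff`. [folklore] -/
theorem isTermGate_gRankSpan_collapse (m l D : ℕ) (g : GateFn) (A : Fin g.1 → Finset (Finset (Fin m)))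
    (hA : ∀ i, A i ⊆ smallSets (Fin m) l)
    (hg : ∃ (F : Type) (_ : Field F) (d θ : ℕ) (K₀ : Matrix (Fin d) (Fin d) F) (K : Fin g.1 → Matrix (Fin d) (Fin d) F),
      Module.finrank F (Submodule.span F (Set.range K)) ≤ D ∧
        ∀ v : Fin g.1 → Bool, g.2 v = true ↔ θ ≤ (symbolicMatrix K₀ K v).rank) :
    IsTermGate m (fun g' => ∃ (F : Type) (_ : Field F) (d θ : ℕ) (K₀ : Matrix (Fin d) (Fin d) F)
      (K : Fin g'.1 → Matrix (Fin d) (Fin d) F), Module.finrank F (Submodule.span F (Set.range K)) ≤ D ∧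
        ∀ v : Fin g'.1 → Bool, g'.2 v = true ↔ θ ≤ (symbolicMatrix K₀ K v).rank) l
      (fun x => g.2 fun i => acceptsB (A i) x) := by
  classical
  obtain ⟨F, _, d, θ, K₀, K, hD, hgK⟩ := hg
  set e := Fintype.equivFin (Σ i : Fin g.1, {X // X ∈ A i}) with he
  set N := Fintype.card (Σ i : Fin g.1, {X // X ∈ A i}) with hN
  set π : Fin N → Fin g.1 := fun a => (e.symm a).1 with hπ
  haveI : Module.Finite F (Submodule.span F (Set.range K)) := Module.Finite.span_of_finite F (Set.finite_range K)
  refine ⟨⟨N, fun w => decide (θ ≤ (symbolicMatrix K₀ (fun a => K (π a)) w).rank)⟩,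
    ⟨F, inferInstance, d, θ, K₀, fun a => K (π a), ?_, fun w => decide_eq_true_iff⟩,
    fun a => ((e.symm a).2 : Finset (Fin m)), fun a => hA _ (e.symm a).2.2, fun x => ?_⟩
  · refine le_trans (Submodule.finrank_mono (Submodule.span_mono ?_)) hD
    rintro _ ⟨a, rfl⟩
    exact ⟨π a, rfl⟩
  · change g.2 (fun i => acceptsB (A i) x) =
      decide (θ ≤ (symbolicMatrix K₀ (fun a => K (π a)) fun a => atomB ((e.symm a).2 : Finset (Fin m)) x).rank)
    rw [Bool.eq_iff_iff, hgK, decide_eq_true_iff]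
    exact (le_rank_symbolicMatrix_rewire_iff π (acceptsB_eq_true_iff_exists_atom A e x) K₀ K θ).symm

/-- **No polynomial-size monotone circuit over `{∧₂, ∨₂} ∪ GRANKSPAN_D`, `D ≤ m^{7/8}/(log₂ m)^5`, computes
`CLIQUE(m, ⌈m^{1/8}⌉)` (unconditional).** For every `c`, eventually in `m`, for every such `D` and every circuit `C` with
`≤ m^c` gates over `{∧₂, ∨₂}` and generic-rank threshold gates (any dimension, threshold, field) whose matrices span a space
of dimension `≤ D`: `¬ C.Computes CLIQUE(m, ⌈m^{1/8}⌉)` — the level-`l` door theorem with the collapse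
`isTermGate_gRankSpan_collapse` and `sgAt_gRankSpan_logWidth`. [folklore] -/
theorem not_computes_clique_of_isOver_gRankSpan_logWidth : ∀ c : ℕ, ∀ᶠ m : ℕ in atTop, ∀ D : ℕ,
    (D : ℝ) ≤ (m : ℝ) ^ (7 / 8 : ℝ) / Real.logb 2 m ^ 5 →
    ∀ C : Circuit (KEdge m), C.IsOver ({GateFn.and 2, GateFn.or 2} ∪
      {g : GateFn | ∃ (F : Type) (_ : Field F) (d θ : ℕ) (K₀ : Matrix (Fin d) (Fin d) F)
        (K : Fin g.1 → Matrix (Fin d) (Fin d) F), Module.finrank F (Submodule.span F (Set.range K)) ≤ D ∧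
          ∀ v : Fin g.1 → Bool, g.2 v = true ↔ θ ≤ (symbolicMatrix K₀ K v).rank}) →
      C.size ≤ m ^ c → ¬ C.Computes (cliqueFn m ⌈(m : ℝ) ^ (1 / 8 : ℝ)⌉₊) := by
  intro c
  filter_upwards [not_computes_clique_of_collapse_level c, sgAt_gRankSpan_logWidth c, logWidth_le_lOf c]
    with m hhost hSG hLl D hD C hC hsize
  refine hhost ((2 * c + 8) * (Nat.log 2 m + 1)) (Nat.le_mul_of_pos_right _ (Nat.succ_pos _)) hLl _ _
    (fun g hg => ?_) (fun g hg A hA => isTermGate_gRankSpan_collapse m _ D g A hA hg) (hSG D hD) C hC hsize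
  obtain ⟨F, _, d, θ, K₀, K, -, hgK⟩ := hg
  exact IsGRankGate.monotone ⟨F, inferInstance, d, θ, le_rfl, K₀, K, hgK⟩

end Summit.PneNP.PneNP.Theorems

end
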